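import Summits.Ventures.GridStability.Models.StructurePreservingLurie

/-!
# GridStability/Models/StructurePreservingLurieRoa — the relative bilinear form IS the
# structure-preserving phase field, and Vu–Turitsyn's Theorem 1 transported to solutions of MODEL MV-3

LADDER-GRIDFUSION G3 (model register) / G2 «SP–Lur'e lane», seat gridfusion-model-2 (g5); companion
of `StructurePreservingLurie.lean` (the object `Params.relLurie`, the coordinate map `relState`, the
observability lemma `relLurie_obs`); `plan/MODEL-VALIDITY.md` row **MV-3**. THREE COLUMNS:
MODELLED column only — an exact identity between two typed vector fields (model-2's
`Params.phaseField` of [cite: Padiyar2013, §3.2 eq (3.2)] / [cite: BergenHill1981] and lit-6's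
`LyapunovFunctionFamily.System.field` of [cite: VuTuritsyn2017, §3 eq. (Bilinear)]) plus the
transport of the tree's kernel theorem [cite: VuTuritsyn2017, §4.3 Theorem 1]
(`QuadraticCertificate.well_subset_regionOfAttraction`,
`Literature/MathematicalPhysics/PowerSystems/LurieQuadraticCertificate.lean`) to solutions of MV-3.
The quadratic certificate `Λ = (P, g, ε)` is a HYPOTHESIS (an exact kernel fact a producer supplies;
none is constructed or claimed here); nothing in this file says a grid is stable.

## Contents (all PROVED)
* `relLurie_field_relState_inl/_inr` — **the field identity**: at `relState(δ, ω)` the angle rows of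
  `(p.relLurie …).field` are `v_{r.succAbove i} − v_r` and the speed rows are `a_{gnode j}`, model-2's
  bus velocities / generator accelerations (`Params.vel`, `Params.acc`), for data with `P⁰ = f(δ*)`;
* `hasDerivWithinAt_relState` — **the bridge**: every phase solution of MV-3 projects to a solution
  of the bilinear system (so every kernel theorem about `ẋ = Ax − BF(Cx)` is an a-priori statement
  about MODEL MV-3);
* `sectorGain_anti`, `gain_lt_sectorGain_of_le` — `g⋆` is antitone in `|δ*|` (chord slopes of the
  concave sine), so ONE inequality `g < g⋆(γ)`, `γ ≥ max_e |δ*_e|`, gives the strict gain on every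
  line [cite: VuTuritsyn2017, §4.2 Lemma 2];
* `tendsto_relState_of_quadraticCertificate` (+ `_of_rankOne`, + `_shifted` for the Lyapunov seat's
  `phaseField p = p.shifted.phaseField`) — **Theorem 1 for MV-3**: given ANY exact quadratic
  certificate for `p.relLurie …` with strict sector gains and a level `c` below `V` on the faces,
  every phase solution whose initial listed line angles lie in `(−π/2, π/2)` and whose initial
  relative state has `V ≤ c` keeps both for all `t ≥ 0` and its relative state tends to `0`;
  `tendsto_of_tendsto_relState` unpacks this as: ALL bus-angle differences `δ_v − δ_w → δ*_v − δ*_w`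
  and all generator frequency deviations `→ 0` (reference-free conclusions);
* `tendsto_of_isSolution_of_quadraticCertificate` — the same in the PRINTED second-order vocabulary
  (`p.IsSolution`, arbitrary `P⁰`, synchronous frequency `ω₀ = ΣP⁰/ΣD`): angle differences converge
  to the equilibrium's, generator speeds `δ̇_v → ω₀`.
CERTIFIED (given `Λ`): statements about MODEL MV-3, CLASS = the certificate's well; inner estimates;
a priori over all solutions (Barbashin–Krasovskii form of lit-6's theorem). MODELLED: MODEL-VALIDITY
MV-3; the reference bus `r` is bookkeeping (conclusions do not depend on it).
-/

noncomputable section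

open Finset Real Set Filter Matrix
open scoped Topology
open Literature.MathematicalPhysics.PowerSystems
open Literature.MathematicalPhysics.PowerSystems.LyapunovFunctionFamily

namespace Summit.Ventures.GridStability.Models.StructurePreserving.Params

variable {k g m : ℕ} {p : Params (k + 1)} {r : Fin (k + 1)} {gnode : Fin g → Fin (k + 1)}
  {src tgt : Fin m → Fin (k + 1)} {wt : Fin m → ℝ} {δs : Fin (k + 1) → ℝ}

/-! ### The field identity: `relState` maps the MV-3 phase field to the bilinear field -/

/-- **Field identity, angle rows.** For well-formed data with `P⁰ = f(δ*)`, reference load bus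
`r ∉ gen` and an injective enumeration `gnode` of `gen`: the angle-row component of
`(relLurie …).field` at `relState(δ, ω)` is `v_{r.succAbove i}(δ, ω) − v_r(δ, ω)`, the difference of
model-2's bus velocities (`Params.vel`: `ω_v` at a generator, `(P⁰_v − f_v(δ))/D_v` at a load bus).
[cite: VuTuritsyn2017, §3 eq. (Bilinear)]; [cite: Padiyar2013, §3.2 eqs (3.2), (3.10)] -/
theorem relLurie_field_relState_inl (hp : p.WellFormed) (hr : r ∉ p.gen)
    (hginj : Function.Injective gnode) (hgen : ∀ v, v ∈ p.gen ↔ ∃ j, gnode j = v)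
    (hb : p.b = symmetrize (edgeWeight src tgt wt)) (hP : ∀ v, p.pe δs v = p.P0 v)
    (z : (Fin (k + 1) → ℝ) × (Fin (k + 1) → ℝ)) (i : Fin k) :
    (p.relLurie r gnode src tgt wt δs).field (relState r gnode δs z) (Sum.inl i)
      = p.vel z (r.succAbove i) - p.vel z r := by
  have hDr := (hp.D_pos r).ne'
  have hDv := (hp.D_pos (r.succAbove i)).ne'
  -- injection deviations in terms of the nonlinearity
  have hT : ∀ v, p.pe z.1 v - p.pe δs v = ∑ e, edgeInc src tgt e v * wt e
      * (p.relLurie r gnode src tgt wt δs).nonlin (relState r gnode δs z) e := by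
    intro v
    rw [p.pe_sub_pe_eq_sum_edgeInc hb z.1 δs v]
    simp only [relLurie_nonlin_relState]
  -- the reference bus's velocity
  have hvr : p.vel z r = -(∑ e, edgeInc src tgt e r * wt e
      * (p.relLurie r gnode src tgt wt δs).nonlin (relState r gnode δs z) e) / p.D r := by
    rw [vel_of_not_mem hr, ← hP r, ← hT r]
    ring
  rw [LyapunovFunctionFamily.System.field, Pi.sub_apply, relLurie_A_mulVec_inl,
    relLurie_B_mulVec_inl, hvr]
  by_cases hvg : r.succAbove i ∈ p.gen
  · obtain ⟨j₀, hj₀⟩ := (hgen _).1 hvg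
    rw [sum_ite_eq_of_injective hginj _ hj₀, relState_inr, hj₀, vel_of_mem hvg]
    simp only [if_pos hvg]
    have key : ∑ e, ((0 : ℝ) - edgeInc src tgt e r / p.D r) * wt e
        * (p.relLurie r gnode src tgt wt δs).nonlin (relState r gnode δs z) e
        = -∑ e, edgeInc src tgt e r * wt e
          * (p.relLurie r gnode src tgt wt δs).nonlin (relState r gnode δs z) e / p.D r := by
      rw [← Finset.sum_neg_distrib]
      exact Finset.sum_congr rfl fun e _ => by ring
    rw [key, neg_div, Finset.sum_div]
  · have hnone : ∀ j, gnode j ≠ r.succAbove i := fun j h => hvg ((hgen _).2 ⟨j, h⟩)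
    rw [sum_ite_eq_zero_of_not_mem_range _ hnone, vel_of_not_mem hvg, ← hP (r.succAbove i)]
    simp only [if_neg hvg]
    have hpe : p.pe δs (r.succAbove i) - p.pe z.1 (r.succAbove i)
        = -∑ e, edgeInc src tgt e (r.succAbove i) * wt e
          * (p.relLurie r gnode src tgt wt δs).nonlin (relState r gnode δs z) e := by
      rw [← hT]; ring
    have key : ∑ e, (edgeInc src tgt e (r.succAbove i) / p.D (r.succAbove i) - edgeInc src tgt e r / p.D r)
        * wt e * (p.relLurie r gnode src tgt wt δs).nonlin (relState r gnode δs z) e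
        = ∑ e, edgeInc src tgt e (r.succAbove i) * wt e
            * (p.relLurie r gnode src tgt wt δs).nonlin (relState r gnode δs z) e / p.D (r.succAbove i)
          - ∑ e, edgeInc src tgt e r * wt e
            * (p.relLurie r gnode src tgt wt δs).nonlin (relState r gnode δs z) e / p.D r := by
      rw [← Finset.sum_sub_distrib]
      exact Finset.sum_congr rfl fun e _ => by ring
    rw [key, hpe, neg_div, neg_div, Finset.sum_div, Finset.sum_div]
    ring

/-- **Field identity, speed rows.** The speed-row component of `(relLurie …).field` at
`relState(δ, ω)` is model-2's generator acceleration `a_v(δ, ω) = (P⁰_v − D_vω_v − f_v(δ))/M_v`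
(`Params.acc`) at `v = gnode j`. [cite: VuTuritsyn2017, §3 eq. (Bilinear)]; [cite: Padiyar2013, §3.2 eq (3.2)] -/
theorem relLurie_field_relState_inr (hp : p.WellFormed)
    (hgen : ∀ v, v ∈ p.gen ↔ ∃ j, gnode j = v)
    (hb : p.b = symmetrize (edgeWeight src tgt wt)) (hP : ∀ v, p.pe δs v = p.P0 v)
    (z : (Fin (k + 1) → ℝ) × (Fin (k + 1) → ℝ)) (j : Fin g) :
    (p.relLurie r gnode src tgt wt δs).field (relState r gnode δs z) (Sum.inr j)
      = p.acc z (gnode j) := by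
  have hvg : gnode j ∈ p.gen := (hgen _).2 ⟨j, rfl⟩
  have hMv := (hp.M_pos _ hvg).ne'
  have hT : p.pe z.1 (gnode j) - p.pe δs (gnode j) = ∑ e, edgeInc src tgt e (gnode j) * wt e
      * (p.relLurie r gnode src tgt wt δs).nonlin (relState r gnode δs z) e := by
    rw [p.pe_sub_pe_eq_sum_edgeInc hb z.1 δs (gnode j)]
    simp only [relLurie_nonlin_relState]
  rw [LyapunovFunctionFamily.System.field, Pi.sub_apply, relLurie_A_mulVec_inr,
    relLurie_B_mulVec_inr, relState_inr, acc_of_mem hvg, ← hP (gnode j)]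
  have hpe : p.pe δs (gnode j) - p.D (gnode j) * z.2 (gnode j) - p.pe z.1 (gnode j)
      = -(∑ e, edgeInc src tgt e (gnode j) * wt e
          * (p.relLurie r gnode src tgt wt δs).nonlin (relState r gnode δs z) e)
        - p.D (gnode j) * z.2 (gnode j) := by
    rw [← hT]; ring
  have key : ∑ e, edgeInc src tgt e (gnode j) / p.M (gnode j) * wt e
      * (p.relLurie r gnode src tgt wt δs).nonlin (relState r gnode δs z) e
      = (∑ e, edgeInc src tgt e (gnode j) * wt e
          * (p.relLurie r gnode src tgt wt δs).nonlin (relState r gnode δs z) e) / p.M (gnode j) := by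
    rw [Finset.sum_div]
    exact Finset.sum_congr rfl fun e _ => by ring
  rw [key, hpe]
  field_simp
  ring

/-- **THE BRIDGE.** Along every phase-space solution `X` of the structure-preserving model
(model-2's `p.phaseField`, data with `P⁰ = f(δ*)`, reference load bus `r ∉ gen`, `gnode` an
injective enumeration of `gen`), the relative state `t ↦ relState(X t)` solves the bilinear system
`(p.relLurie …).field` (within any set `s`). Hence every kernel theorem about solutions of
`ẋ = Ax − BF(Cx)` for this `(A, B, C, δ*)` is an a-priori statement about solutions of MODEL MV-3.
[cite: VuTuritsyn2017, §3 eq. (Bilinear)] -/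
theorem hasDerivWithinAt_relState (hp : p.WellFormed) (hr : r ∉ p.gen)
    (hginj : Function.Injective gnode) (hgen : ∀ v, v ∈ p.gen ↔ ∃ j, gnode j = v)
    (hb : p.b = symmetrize (edgeWeight src tgt wt)) (hP : ∀ v, p.pe δs v = p.P0 v)
    {X : ℝ → (Fin (k + 1) → ℝ) × (Fin (k + 1) → ℝ)} {s : Set ℝ} {t : ℝ}
    (hX : HasDerivWithinAt X (p.phaseField (X t)) s t) :
    HasDerivWithinAt (fun τ => relState r gnode δs (X τ))
      ((p.relLurie r gnode src tgt wt δs).field (relState r gnode δs (X t))) s t := by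
  rw [hasDerivWithinAt_pi]
  intro a
  rcases a with i | j
  · have h1 := (fstCoord (n := k + 1) (r.succAbove i)).hasFDerivAt.comp_hasDerivWithinAt t hX
    have h2 := (fstCoord (n := k + 1) r).hasFDerivAt.comp_hasDerivWithinAt t hX
    have h := (h1.sub h2).sub_const (δs (r.succAbove i) - δs r)
    rw [relLurie_field_relState_inl hp hr hginj hgen hb hP]
    simpa [Function.comp_def, fstCoord_apply, phaseField_fst] using h
  · have h := (sndCoord (n := k + 1) (gnode j)).hasFDerivAt.comp_hasDerivWithinAt t hX
    rw [relLurie_field_relState_inr hp hgen hb hP]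
    simpa [Function.comp_def, sndCoord_apply, phaseField_snd] using h

/-! ### The uniform gain of Lemma 2: one gain below `g⋆(γ)` serves every line with `|δ*_e| ≤ γ` -/

/-- **`g⋆` is antitone in `|δ*|` on `[0, π/2)`**: `g⋆(s) = (1 − sin s)/(π/2 − s)` is the slope of
the chord of the (strictly concave) sine from `s` to `π/2`, which decreases as `s` increases. Hence
the paper's uniform gain `g = (1 − sin γ)/(π/2 − γ)` with `γ ≥ max_e |δ*_e|` is below every line's
`g⋆(δ*_e)`. [cite: VuTuritsyn2017, §4.2 Lemma 2 (uniform gain g with γ ≥ |δ*_kj|)] -/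
theorem sectorGain_anti {a b : ℝ} (hab : |a| ≤ |b|) (hb : |b| < π / 2) :
    sectorGain b ≤ sectorGain a := by
  rcases hab.eq_or_lt with h | h
  · rw [sectorGain, sectorGain, h]
  · have hπ := Real.pi_pos
    have key := strictConcaveOn_sin_Icc.secant_strict_mono (a := π / 2) (x := |a|) (y := |b|)
      ⟨by linarith, by linarith⟩ ⟨abs_nonneg a, by linarith⟩ ⟨abs_nonneg b, by linarith⟩
      (by linarith) (by linarith) h
    rw [Real.sin_pi_div_two, ← neg_div_neg_eq, neg_sub, neg_sub,
      ← neg_div_neg_eq (Real.sin |a| - 1), neg_sub, neg_sub] at key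
    rw [sectorGain, sectorGain]
    exact key.le

/-- **One gain check for all lines**: if every equilibrium line angle satisfies `|δ*_e| ≤ γ` with
`0 ≤ γ < π/2` and `g < g⋆(γ)`, then `g < g⋆(δ*_e)` for every line (the hypothesis `hg` of the
transported Theorem 1 from ONE scalar inequality). [cite: VuTuritsyn2017, §4.2 Lemma 2] -/
theorem gain_lt_sectorGain_of_le {m : ℕ} {σs : Fin m → ℝ} {γ g : ℝ} (hγ0 : 0 ≤ γ)
    (hγ : γ < π / 2) (hσ : ∀ e, |σs e| ≤ γ) (hg : g < sectorGain γ) (e : Fin m) :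
    g < sectorGain (σs e) := by
  have h := sectorGain_anti (a := σs e) (b := γ) (by rw [abs_of_nonneg hγ0]; exact hσ e)
    (by rw [abs_of_nonneg hγ0]; exact hγ)
  exact hg.trans_le h

/-! ### Theorem 1 transported to solutions of MODEL MV-3 -/

/-- **Vu–Turitsyn's Theorem 1 as an a-priori statement about the structure-preserving model.**
Data: well-formed `p : Params (k+1)` with edge-list couplings, preconnected coupling graph,
`P⁰ = f(δ*)`, reference load bus `r ∉ gen`, `gnode` an injective enumeration of `gen`; ANY exact
quadratic certificate `Λ = (P, g, ε)` for `p.relLurie …` (Lemma 1's matrix inequality — a kernel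
fact supplied by a producer, NOT constructed here) with equilibrium line angles `|δ*_e| < π/2`,
STRICT gains `g < g⋆(δ*_e)`, and a level `c` with `c < V` on the faces of the sector polytope.
Conclusion: every phase solution `X` of MV-3 (`p.phaseField`, tree convention on every `[0, T]`)
whose initial listed line angles lie in `(−π/2, π/2)` and with `V(relState(X 0)) ≤ c` keeps both
for all `t ≥ 0`, and its relative state tends to `0`. CERTIFIED (given `Λ`): a statement about
MODEL MV-3, CLASS = the well; inner estimate. [cite: VuTuritsyn2017, §4.3 Theorem 1] -/
theorem tendsto_relState_of_quadraticCertificate (hp : p.WellFormed) (hr : r ∉ p.gen)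
    (hginj : Function.Injective gnode) (hgen : ∀ v, v ∈ p.gen ↔ ∃ j, gnode j = v)
    (hb : p.b = symmetrize (edgeWeight src tgt wt)) (hconn : p.couplingGraph.Preconnected)
    (hP : ∀ v, p.pe δs v = p.P0 v)
    (Λ : QuadraticCertificate (p.relLurie r gnode src tgt wt δs))
    (hδs : ∀ e, |δs (src e) - δs (tgt e)| < π / 2)
    (hg : ∀ e, Λ.g < sectorGain (δs (src e) - δs (tgt e)))
    {c : ℝ} (hfr : ∀ x ∈ frontier (p.relLurie r gnode src tgt wt δs).halfPolytope, c < Λ.V x)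
    {X : ℝ → (Fin (k + 1) → ℝ) × (Fin (k + 1) → ℝ)}
    (hX : ∀ T : ℝ, ∀ t ∈ Icc 0 T, HasDerivWithinAt X (p.phaseField (X t)) (Icc 0 T) t)
    (h0 : ∀ e, |(X 0).1 (src e) - (X 0).1 (tgt e)| < π / 2)
    (hc : Λ.V (relState r gnode δs (X 0)) ≤ c) :
    (∀ t, 0 ≤ t → (∀ e, |(X t).1 (src e) - (X t).1 (tgt e)| < π / 2) ∧
        Λ.V (relState r gnode δs (X t)) ≤ c) ∧
      Tendsto (fun t => relState r gnode δs (X t)) atTop (𝓝 0) := by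
  have hobs := relLurie_obs (δs := δs) hr hginj hgen hb hconn
  have hy : relState r gnode δs (X 0) ∈ (p.relLurie r gnode src tgt wt δs).halfPolytope :=
    (mem_halfPolytope_relState_iff p r gnode src tgt wt δs (X 0)).2 h0
  have hrel : ∀ T : ℝ, ∀ t ∈ Icc 0 T, HasDerivWithinAt (fun τ => relState r gnode δs (X τ))
      ((p.relLurie r gnode src tgt wt δs).field (relState r gnode δs (X t))) (Icc 0 T) t :=
    fun T t ht => hasDerivWithinAt_relState hp hr hginj hgen hb hP (hX T t ht)
  obtain ⟨-, hall⟩ := Λ.well_subset_regionOfAttraction hδs hg hobs hfr hy hc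
  obtain ⟨hstay, hlim⟩ := hall (fun τ => relState r gnode δs (X τ)) rfl hrel
  refine ⟨fun t ht => ⟨?_, (hstay t ht).2⟩, hlim⟩
  exact (mem_halfPolytope_relState_iff p r gnode src tgt wt δs (X t)).1 (hstay t ht).1

/-- **Theorem 1 for MV-3 with the closed-form certified level** from rank-one facts
`s_e·P − C_eᵀC_e ⪰ 0`, `s_e > 0`: every `c < min_e (π/2 − |δ*_e|)²/s_e` is admissible.
[cite: VuTuritsyn2017, §4.3 Theorem 1 with eq. (V_min)] -/
theorem tendsto_relState_of_quadraticCertificate_of_rankOne (hp : p.WellFormed) (hr : r ∉ p.gen)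
    (hginj : Function.Injective gnode) (hgen : ∀ v, v ∈ p.gen ↔ ∃ j, gnode j = v)
    (hb : p.b = symmetrize (edgeWeight src tgt wt)) (hconn : p.couplingGraph.Preconnected)
    (hP : ∀ v, p.pe δs v = p.P0 v)
    (Λ : QuadraticCertificate (p.relLurie r gnode src tgt wt δs))
    (hδs : ∀ e, |δs (src e) - δs (tgt e)| < π / 2)
    (hg : ∀ e, Λ.g < sectorGain (δs (src e) - δs (tgt e)))
    {s : Fin m → ℝ} (hs0 : ∀ e, 0 < s e)
    (hs : ∀ e, (s e • Λ.P - Matrix.vecMulVec ((p.relLurie r gnode src tgt wt δs).C e)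
      ((p.relLurie r gnode src tgt wt δs).C e)).PosSemidef)
    {c : ℝ} (hcs : ∀ e, c < (π / 2 - |δs (src e) - δs (tgt e)|) ^ 2 / s e)
    {X : ℝ → (Fin (k + 1) → ℝ) × (Fin (k + 1) → ℝ)}
    (hX : ∀ T : ℝ, ∀ t ∈ Icc 0 T, HasDerivWithinAt X (p.phaseField (X t)) (Icc 0 T) t)
    (h0 : ∀ e, |(X 0).1 (src e) - (X 0).1 (tgt e)| < π / 2)
    (hc : Λ.V (relState r gnode δs (X 0)) ≤ c) :
    (∀ t, 0 ≤ t → (∀ e, |(X t).1 (src e) - (X t).1 (tgt e)| < π / 2) ∧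
        Λ.V (relState r gnode δs (X t)) ≤ c) ∧
      Tendsto (fun t => relState r gnode δs (X t)) atTop (𝓝 0) :=
  tendsto_relState_of_quadraticCertificate hp hr hginj hgen hb hconn hP Λ hδs hg
    (fun _ hx => Λ.lt_V_of_mem_frontier_halfPolytope hδs hs0 hs hcs hx) hX h0 hc

/-- **Unpacking `relState → 0` in MV-3 vocabulary**: every bus-angle DIFFERENCE converges to its
equilibrium value, `δ_v(t) − δ_w(t) → δ*_v − δ*_w`, and every generator frequency deviation
`ω_v(t) → 0` (`v ∈ gen`). (The reference bus drops out: angle differences do not depend on it.) -/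
theorem tendsto_of_tendsto_relState (hgen : ∀ v, v ∈ p.gen ↔ ∃ j, gnode j = v)
    {X : ℝ → (Fin (k + 1) → ℝ) × (Fin (k + 1) → ℝ)}
    (hlim : Tendsto (fun t => relState r gnode δs (X t)) atTop (𝓝 0)) :
    (∀ v w, Tendsto (fun t => (X t).1 v - (X t).1 w) atTop (𝓝 (δs v - δs w))) ∧
      ∀ v ∈ p.gen, Tendsto (fun t => (X t).2 v) atTop (𝓝 0) := by
  -- each relative angle
  have hrel : ∀ v, Tendsto (fun t => (X t).1 v - (X t).1 r) atTop (𝓝 (δs v - δs r)) := by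
    intro v
    rcases Fin.eq_self_or_eq_succAbove r v with rfl | ⟨i, rfl⟩
    · simp only [sub_self]; exact tendsto_const_nhds
    · have h := ((continuous_apply (Sum.inl i)).tendsto _).comp hlim
      have h' : Tendsto (fun t => ((X t).1 (r.succAbove i) - (X t).1 r
          - (δs (r.succAbove i) - δs r)) + (δs (r.succAbove i) - δs r)) atTop
          (𝓝 (0 + (δs (r.succAbove i) - δs r))) := by
        refine Tendsto.add_const _ ?_
        simpa [Function.comp_def] using h
      simpa using h'
  refine ⟨fun v w => ?_, fun v hv => ?_⟩
  · have h := (hrel v).sub (hrel w)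
    have e1 : (fun t => (X t).1 v - (X t).1 r - ((X t).1 w - (X t).1 r))
        = fun t => (X t).1 v - (X t).1 w := by funext t; ring
    have e2 : δs v - δs r - (δs w - δs r) = δs v - δs w := by ring
    rw [e1, e2] at h
    exact h
  · obtain ⟨j, rfl⟩ := (hgen v).1 hv
    have h := ((continuous_apply (Sum.inr j)).tendsto _).comp hlim
    simpa [Function.comp_def] using h

/-! ### The frame rotating at the synchronous frequency (`p.shifted`; the Lyapunov seat's `phaseField p`) -/

/-- **Theorem 1 for MV-3 in the frame rotating at the synchronous frequency** (the Lyapunov seat's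
convention `Lyapunov.StructurePreserving.phaseField p = p.shifted.phaseField`,
`StructurePreservingPhaseBridge.lyapunov_phaseField_eq`): for a synchronous equilibrium `δ*` of `p`
(`f(δ*) = P̄` [cite: Padiyar2013, §3.2 eqs (3.3)–(3.5), Remark 1]) the statement of
`tendsto_relState_of_quadraticCertificate` holds for phase solutions of `p.shifted.phaseField`, with a
certificate for `p.relLurie …` itself (the bilinear object does not see `P⁰`, `shifted_relLurie`).
[cite: VuTuritsyn2017, §4.3 Theorem 1] -/
theorem tendsto_relState_of_quadraticCertificate_shifted (hp : p.WellFormed) (hr : r ∉ p.gen)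
    (hginj : Function.Injective gnode) (hgen : ∀ v, v ∈ p.gen ↔ ∃ j, gnode j = v)
    (hb : p.b = symmetrize (edgeWeight src tgt wt)) (hconn : p.couplingGraph.Preconnected)
    (hδeq : p.IsSyncEquilibrium δs)
    (Λ : QuadraticCertificate (p.relLurie r gnode src tgt wt δs))
    (hδs : ∀ e, |δs (src e) - δs (tgt e)| < π / 2)
    (hg : ∀ e, Λ.g < sectorGain (δs (src e) - δs (tgt e)))
    {c : ℝ} (hfr : ∀ x ∈ frontier (p.relLurie r gnode src tgt wt δs).halfPolytope, c < Λ.V x)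
    {X : ℝ → (Fin (k + 1) → ℝ) × (Fin (k + 1) → ℝ)}
    (hX : ∀ T : ℝ, ∀ t ∈ Icc 0 T, HasDerivWithinAt X (p.shifted.phaseField (X t)) (Icc 0 T) t)
    (h0 : ∀ e, |(X 0).1 (src e) - (X 0).1 (tgt e)| < π / 2)
    (hc : Λ.V (relState r gnode δs (X 0)) ≤ c) :
    (∀ t, 0 ≤ t → (∀ e, |(X t).1 (src e) - (X t).1 (tgt e)| < π / 2) ∧
        Λ.V (relState r gnode δs (X t)) ≤ c) ∧
      Tendsto (fun t => relState r gnode δs (X t)) atTop (𝓝 0) :=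
  have hp' : p.shifted.WellFormed := ⟨hp.M_pos, hp.M_eq_zero, hp.D_pos, hp.b_symm⟩
  have hP' : ∀ v, p.shifted.pe δs v = p.shifted.P0 v := fun v => by
    rw [shifted_pe, shifted_P0]; exact hδeq v
  tendsto_relState_of_quadraticCertificate (p := p.shifted) hp' hr hginj hgen hb hconn hP' Λ hδs hg
    hfr hX h0 hc

/-! ### The printed second-order vocabulary, any `P⁰` (frame-free conclusions) -/

/-- **Vu–Turitsyn's Theorem 1 for the structure-preserving model AS PRINTED.** Data as in
`tendsto_relState_of_quadraticCertificate` but for a synchronous equilibrium `δ*` of arbitrary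
powers `P⁰` (`f(δ*) = P̄`, synchronous frequency `ω₀ = ΣP⁰/ΣD` [cite: Padiyar2013, §3.2 eqs (3.3)–(3.5)]),
a certificate for the same bilinear object `p.relLurie …` (it does not see `P⁰`). For every solution `δ(t)` of the printed model
`Mᵥδ̈ᵥ + Dᵥδ̇ᵥ + fᵥ(δ) = P⁰ᵥ` (`p.IsSolution`) whose initial listed line angles lie in `(−π/2, π/2)` and
whose initial relative state `relState(δ(0), δ̇(0) − ω₀)` has `V ≤ c`: the listed line angles stay in
`(−π/2, π/2)` for all `t ≥ 0`, every angle difference `δᵥ(t) − δ_w(t) → δ*ᵥ − δ*_w`, and every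
generator speed deviation `δ̇ᵥ(t) → ω₀`. MODEL MV-3, CLASS = the certificate's well; nothing here
says a grid is stable. [cite: VuTuritsyn2017, §4.3 Theorem 1] -/
theorem tendsto_of_isSolution_of_quadraticCertificate (hp : p.WellFormed) (hr : r ∉ p.gen)
    (hginj : Function.Injective gnode) (hgen : ∀ v, v ∈ p.gen ↔ ∃ j, gnode j = v)
    (hb : p.b = symmetrize (edgeWeight src tgt wt)) (hconn : p.couplingGraph.Preconnected)
    (hδeq : p.IsSyncEquilibrium δs)
    (Λ : QuadraticCertificate (p.relLurie r gnode src tgt wt δs))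
    (hδs : ∀ e, |δs (src e) - δs (tgt e)| < π / 2)
    (hg : ∀ e, Λ.g < sectorGain (δs (src e) - δs (tgt e)))
    {c : ℝ} (hfr : ∀ x ∈ frontier (p.relLurie r gnode src tgt wt δs).halfPolytope, c < Λ.V x)
    {δ : ℝ → Fin (k + 1) → ℝ} (hδ : p.IsSolution δ)
    (h0 : ∀ e, |δ 0 (src e) - δ 0 (tgt e)| < π / 2)
    (hc : Λ.V (relState r gnode δs (δ 0, fun v => deriv (fun u => δ u v) 0 - p.syncFreq)) ≤ c) :
    (∀ t, 0 ≤ t → ∀ e, |δ t (src e) - δ t (tgt e)| < π / 2) ∧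
      (∀ v w, Tendsto (fun t => δ t v - δ t w) atTop (𝓝 (δs v - δs w))) ∧
      ∀ v ∈ p.gen, Tendsto (fun t => deriv (fun u => δ u v) t) atTop (𝓝 p.syncFreq) := by
  -- the shifted solution and its phase curve
  have hs := hδ.shift
  have hp' : p.shifted.WellFormed := ⟨hp.M_pos, hp.M_eq_zero, hp.D_pos, hp.b_symm⟩
  set X := p.shifted.toPhase (fun t i => δ t i - p.syncFreq * t) with hXdef
  have hX : ∀ T : ℝ, ∀ t ∈ Icc 0 T,
      HasDerivWithinAt X (p.shifted.phaseField (X t)) (Icc 0 T) t :=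
    fun T t _ => (hs.hasDerivAt_toPhase hp' t).hasDerivWithinAt
  have hderiv : ∀ v t, deriv (fun s => δ s v - p.syncFreq * s) t
      = deriv (fun s => δ s v) t - p.syncFreq := by
    intro v t
    have h1 := ((hδ.differentiable v) t).hasDerivAt
    have h2 : HasDerivAt (fun s : ℝ => p.syncFreq * s) p.syncFreq t := by
      simpa using (hasDerivAt_id t).const_mul p.syncFreq
    exact (h1.sub h2).deriv
  have hX1 : ∀ t v w, (X t).1 v - (X t).1 w = δ t v - δ t w := by
    intro t v w
    simp only [hXdef, toPhase_fst]
    ring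
  have hX0 : relState r gnode δs (X 0)
      = relState r gnode δs (δ 0, fun v => deriv (fun u => δ u v) 0 - p.syncFreq) := by
    funext a
    rcases a with i | j
    · simp only [relState_inl, hX1]
    · have hjg : gnode j ∈ p.shifted.gen := (hgen _).2 ⟨j, rfl⟩
      simp only [relState_inr, hXdef, toPhase_snd_of_mem hjg, hderiv]
  have h0' : ∀ e, |(X 0).1 (src e) - (X 0).1 (tgt e)| < π / 2 := fun e => by
    rw [hX1]; exact h0 e
  have hc' : Λ.V (relState r gnode δs (X 0)) ≤ c := by rw [hX0]; exact hc
  obtain ⟨hstay, hlim⟩ := tendsto_relState_of_quadraticCertificate_shifted hp hr hginj hgen hb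
    hconn hδeq Λ hδs hg hfr hX h0' hc'
  obtain ⟨hdiff, hfreq⟩ := tendsto_of_tendsto_relState (p := p.shifted) (r := r) (δs := δs) hgen
    hlim
  refine ⟨fun t ht e => ?_, fun v w => ?_, fun v hv => ?_⟩
  · have := (hstay t ht).1 e
    rwa [hX1] at this
  · have h := hdiff v w
    simp only [hX1] at h
    exact h
  · have hv' : v ∈ p.shifted.gen := hv
    have h := hfreq v hv'
    have e1 : (fun t => (X t).2 v) = fun t => deriv (fun u => δ u v) t - p.syncFreq := by
      funext t
      simp only [hXdef, toPhase_snd_of_mem hv', hderiv]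
    rw [e1] at h
    have h' := h.add_const p.syncFreq
    simpa using h'

end Summit.Ventures.GridStability.Models.StructurePreserving.Params

end
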